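import Literature.Analysis.FluidPDE.CollisionPayload
import HarnessLib

/-!
# Time dilation of hard-sphere trajectories

The hard-sphere dynamics has no intrinsic time scale: if `γ` is a hard-sphere trajectory of `N`
spheres of diameter `ε` (`Kinetic.IsHardSphereTrajectory`, GST 2013 Def. 4.1.2), then for every
`c > 0` so is the *time-dilated* curve `s ↦ (x(cs), c v(cs))` — same positions run through `c`
times faster, velocities multiplied by `c` (free flight is linear in `t v`, the contact condition
only sees positions, the reflection law is linear in the velocities and incoming pairs stay
incoming). This is the scaling `τ = μ t`, `v ↦ μ v`, `E ↦ μ² E` by which D. Serre makes his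
collision estimates dimensionally homogeneous (Serre 2024, §3 p. 1436 and §5 p. 1439: "the change
of time `τ = μt` yields another motion, though with particle velocities `μv`. The corresponding
energy per cell is `μ⁻² E`"), and the reduction of a kinetic time slab to a window of unit length.

## Contents

* `Kinetic.scaleVel c z` — multiply all velocities of a configuration by `c`, keep the positions;
  `scaleVel_mem_hardSphereDomain_iff`, `scaleVel_mem_contactSet_iff`, `isIncoming_scaleVel_iff`,
  `collidePair_scaleVel` (the collision law commutes with `scaleVel`), `freeFlight_scaleVel`
  (`S_t (scaleVel c z) = scaleVel c (S_{ct} z)`), `configEnergy_scaleVel` (`E ↦ c² E`).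
* `Kinetic.timeDilate c γ = fun s => scaleVel c (γ (c * s))`; `collisionTimes_timeDilate`
  (`= (c * ·) ⁻¹' collisionTimes γ`), `leftLim_timeDilate`, `velocityJump_timeDilate`
  (`= c · velocityJump γ (cs)`), `collisionPayload_timeDilate`
  (`pay(γ_c)[a, b] = c · pay(γ)[ca, cb]`), `numCollisions_timeDilate`, and the closure theorem
  **`IsHardSphereTrajectory.timeDilate`**.

## Design choices

* Only `c > 0` (orientation of time is kept; time reversal is `Kinetic.timeReverse`). For `c < 0`
  the dilated curve would be left-continuous at collisions and `free`/`binary` fail as stated.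
* General geometry `G` and position space `X`; left limits need Hausdorff positions as in
  `HardSphereDynamicsProofs` / `CollisionPayload`.
* Not here: the space scaling `z ↦ c • z` of the Euclidean geometry
  (`HardSphereEuclideanScaling`, diameter `ε ↦ cε`), which has no analogue on a fixed torus.

## References

* D. Serre, *Compensated integrability on tori; a priori estimate for space-periodic gas flows*,
  C. R. Math. Acad. Sci. Paris 362 (2024) 1425–1444, §3 (p. 1436), §5 (p. 1439). [Serre2024]
* I. Gallagher, L. Saint-Raymond, B. Texier, *From Newton to Boltzmann* (2013), §4.1.
-/

open Set Filter Function
open scoped InnerProductSpace Topology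

namespace Literature.Analysis.FluidPDE

noncomputable section

section NoFintype

variable {d : Type*} {X : Type*} {N : ℕ}

/-- Multiply every velocity of a configuration by `c`, keeping the positions:
`(x_i, v_i) ↦ (x_i, c v_i)` (the velocity part of Serre's scaling `v ↦ μ v`).
[cite: Serre2024, §5 p. 1439] -/
def scaleVel (c : ℝ) (z : Config N d X) : Config N d X := fun i => ((z i).1, c • (z i).2)

/-- Unfolding lemma for `scaleVel`. [folklore] -/
@[simp]
theorem scaleVel_apply (c : ℝ) (z : Config N d X) (i : Fin N) :
    scaleVel c z i = ((z i).1, c • (z i).2) := rfl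

/-- Scaling the velocities by `1` does nothing. [folklore] -/
@[simp]
theorem scaleVel_one (z : Config N d X) : scaleVel 1 z = z := by
  funext i
  simp

/-- Velocity scalings compose multiplicatively. [folklore] -/
theorem scaleVel_scaleVel (a b : ℝ) (z : Config N d X) :
    scaleVel a (scaleVel b z) = scaleVel (a * b) z := by
  funext i
  simp [smul_smul]

/-- `scaleVel c⁻¹` undoes `scaleVel c` for `c ≠ 0`. [folklore] -/
theorem scaleVel_inv_scaleVel {c : ℝ} (hc : c ≠ 0) (z : Config N d X) :
    scaleVel c⁻¹ (scaleVel c z) = z := by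
  rw [scaleVel_scaleVel, inv_mul_cancel₀ hc, scaleVel_one]

/-- The TIME DILATION by the factor `c` of a curve in phase space: `s ↦ (x(cs), c v(cs))` — the
same positions run through `c` times faster, with velocities multiplied by `c` (Serre's
`τ = μ t`, `v ↦ μ v`). [cite: Serre2024, §5 p. 1439] -/
def timeDilate (c : ℝ) (γ : ℝ → Config N d X) : ℝ → Config N d X :=
  fun s => scaleVel c (γ (c * s))

/-- Unfolding lemma for `timeDilate`. [folklore] -/
@[simp]
theorem timeDilate_apply (c : ℝ) (γ : ℝ → Config N d X) (s : ℝ) :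
    timeDilate c γ s = scaleVel c (γ (c * s)) := rfl

/-- Dilation by `1` does nothing. [folklore] -/
@[simp]
theorem timeDilate_one (γ : ℝ → Config N d X) : timeDilate 1 γ = γ := by
  funext s
  simp

end NoFintype

section Kinetic

variable {d : Type*} [Fintype d] {X : Type*} {N : ℕ} {G : Geometry d X} {c : ℝ}

/-- `scaleVel c` is continuous. [folklore] -/
theorem continuous_scaleVel [TopologicalSpace X] (c : ℝ) :
    Continuous (scaleVel c : Config N d X → Config N d X) :=
  continuous_pi fun i => (continuous_apply i).fst.prodMk ((continuous_apply i).snd.const_smul c)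

/-- Scaling the velocities does not move the particles: the hard-sphere domain is invariant.
[folklore] -/
@[simp]
theorem scaleVel_mem_hardSphereDomain_iff {ε : ℝ} {z : Config N d X} :
    scaleVel c z ∈ hardSphereDomain G N ε ↔ z ∈ hardSphereDomain G N ε := by
  simp [mem_hardSphereDomain]

/-- Contact sets only see positions. [folklore] -/
@[simp]
theorem scaleVel_mem_contactSet_iff {ε : ℝ} {i j : Fin N} {z : Config N d X} :
    scaleVel c z ∈ contactSet G N ε i j ↔ z ∈ contactSet G N ε i j := by
  simp [mem_contactSet, mem_hardSphereDomain]

/-- The normal relative velocity scales by `c`. [folklore] -/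
theorem inner_sepVec_scaleVel (c : ℝ) (z : Config N d X) (i j : Fin N) :
    ⟪G.sepVec (scaleVel c z i).1 (scaleVel c z j).1, (scaleVel c z i).2 - (scaleVel c z j).2⟫_ℝ =
      c * ⟪G.sepVec (z i).1 (z j).1, (z i).2 - (z j).2⟫_ℝ := by
  simp only [scaleVel_apply, ← smul_sub, real_inner_smul_right]

/-- Scaling the velocities by `c > 0` preserves incoming pairs. [folklore] -/
theorem isIncoming_scaleVel_iff (hc : 0 < c) {z : Config N d X} {i j : Fin N} :
    IsIncoming G (scaleVel c z) i j ↔ IsIncoming G z i j := by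
  rw [IsIncoming, IsIncoming, inner_sepVec_scaleVel]
  constructor <;> intro h <;> nlinarith

/-- Scaling the velocities by `c > 0` preserves outgoing pairs. [folklore] -/
theorem isOutgoing_scaleVel_iff (hc : 0 < c) {z : Config N d X} {i j : Fin N} :
    IsOutgoing G (scaleVel c z) i j ↔ IsOutgoing G z i j := by
  rw [IsOutgoing, IsOutgoing, inner_sepVec_scaleVel]
  constructor <;> intro h <;> nlinarith

/-- The elastic collision of a pair commutes with the scaling of the velocities (the reflection
law `reflectVel` is linear in the pair of velocities and the impact direction is unchanged).
[folklore] -/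
theorem collidePair_scaleVel (c : ℝ) (i j : Fin N) (z : Config N d X) :
    collidePair G i j (scaleVel c z) = scaleVel c (collidePair G i j z) := by
  have hR : ∀ (n v w : EuclideanSpace ℝ d),
      reflectVel n (c • v, c • w) = (c • (reflectVel n (v, w)).1, c • (reflectVel n (v, w)).2) := by
    intro n v w
    have h : ⟪c • v - c • w, n⟫_ℝ = c * ⟪v - w, n⟫_ℝ := by
      rw [← smul_sub, real_inner_smul_left]
    simp only [reflectVel, h, smul_sub, smul_add, smul_smul, mul_div_assoc]
  funext k
  by_cases hkj : k = j
  · subst hkj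
    simp only [scaleVel_apply, collidePair_apply_right, hR]
  by_cases hki : k = i
  · subst hki
    simp only [scaleVel_apply, collidePair_apply_left hkj, hR]
  simp only [scaleVel_apply, collidePair_apply_of_ne hki hkj]

/-- Free flight for time `t` after scaling the velocities by `c` is free flight for time `c t`
before: `S_t (scaleVel c z) = scaleVel c (S_{ct} z)`. [folklore] -/
theorem freeFlight_scaleVel (c t : ℝ) (z : Config N d X) :
    freeFlight G t (scaleVel c z) = scaleVel c (freeFlight G (c * t) z) := by
  funext i
  simp only [freeFlight_apply, scaleVel_apply, smul_smul, mul_comm t c]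

/-- The kinetic energy scales quadratically: `E(scaleVel c z) = c² E(z)`. [cite: Serre2024, §5 p. 1439] -/
theorem configEnergy_scaleVel (c : ℝ) (z : Config N d X) :
    configEnergy (scaleVel c z) = c ^ 2 * configEnergy z := by
  simp only [configEnergy, scaleVel_apply, norm_smul, Real.norm_eq_abs, mul_pow, sq_abs,
    Finset.mul_sum]
  ring_nf

omit [Fintype d] in
/-- The total momentum scales linearly. [folklore] -/
theorem configMomentum_scaleVel (c : ℝ) (z : Config N d X) :
    configMomentum (scaleVel c z) = c • configMomentum z := by
  simp only [configMomentum, scaleVel_apply, Finset.smul_sum]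

/-! ## Collision times, left limits and payload of the dilated curve -/

/-- The collision times of the dilated curve are the rescaled collision times:
`t ∈ C(γ_c) ↔ c t ∈ C(γ)` (contact only sees positions). [folklore] -/
theorem collisionTimes_timeDilate (c : ℝ) (ε : ℝ) (γ : ℝ → Config N d X) :
    collisionTimes G ε (timeDilate c γ) = (fun s => c * s) ⁻¹' collisionTimes G ε γ := by
  ext s
  simp only [mem_collisionTimes, mem_preimage, timeDilate_apply, scaleVel_mem_contactSet_iff]

/-- `s ↦ c s` maps left neighbourhoods to left neighbourhoods for `c > 0`. [folklore] -/
theorem tendsto_const_mul_nhdsLT_of_pos (hc : 0 < c) (s : ℝ) :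
    Tendsto (fun τ : ℝ => c * τ) (𝓝[<] s) (𝓝[<] (c * s)) :=
  tendsto_nhdsWithin_of_tendsto_nhds_of_eventually_within _
    (((continuous_const_mul c).tendsto s).mono_left nhdsWithin_le_nhds)
    (eventually_nhdsWithin_of_forall fun _ hτ => mul_lt_mul_of_pos_left hτ hc)

/-- Limits from the left along `τ ↦ γ (c τ)` at `s` are limits from the left of `γ` at `c s`
(`c > 0`). [folklore] -/
theorem tendsto_comp_const_mul_nhdsLT_iff {β : Type*} (hc : 0 < c) {γ : ℝ → β} {s : ℝ}
    {l : Filter β} :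
    Tendsto (fun τ => γ (c * τ)) (𝓝[<] s) l ↔ Tendsto γ (𝓝[<] (c * s)) l := by
  constructor
  · intro h
    have h0 := tendsto_const_mul_nhdsLT_of_pos (inv_pos.2 hc) (c * s)
    rw [inv_mul_cancel_left₀ hc.ne'] at h0
    refine (h.comp h0).congr fun τ => ?_
    simp only [Function.comp_apply, mul_inv_cancel_left₀ hc.ne']
  · intro h
    exact h.comp (tendsto_const_mul_nhdsLT_of_pos hc s)

/-- Left limits of the dilated curve (`c > 0`, Hausdorff positions):
`(γ_c)(s⁻) = scaleVel c (γ((cs)⁻))`. [folklore] -/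
theorem leftLim_timeDilate [TopologicalSpace X] [T2Space X] (hc : 0 < c) (γ : ℝ → Config N d X)
    (s : ℝ) : leftLim (timeDilate c γ) s = scaleVel c (leftLim γ (c * s)) := by
  by_cases hγ : ∃ y, Tendsto γ (𝓝[<] (c * s)) (𝓝 y)
  · obtain ⟨y, hy⟩ := hγ
    have h1 : Tendsto (timeDilate c γ) (𝓝[<] s) (𝓝 (scaleVel c y)) :=
      ((continuous_scaleVel c).tendsto y).comp ((tendsto_comp_const_mul_nhdsLT_iff hc).2 hy)
    rw [leftLim_eq_of_tendsto hy, leftLim_eq_of_tendsto h1]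
  · rw [leftLim_eq_of_not_tendsto _ hγ, leftLim_eq_of_not_tendsto, timeDilate_apply]
    rintro ⟨w, hw⟩
    refine hγ ⟨scaleVel c⁻¹ w, (tendsto_comp_const_mul_nhdsLT_iff hc).1 ?_⟩
    have h2 := ((continuous_scaleVel c⁻¹).tendsto w).comp hw
    refine h2.congr fun τ => ?_
    simp only [Function.comp_apply, timeDilate_apply, scaleVel_inv_scaleVel hc.ne']

/-- Velocity jumps of the dilated curve: `jump(γ_c)(s) = c · jump(γ)(cs)` (`c > 0`). [folklore] -/
theorem velocityJump_timeDilate [TopologicalSpace X] [T2Space X] (hc : 0 < c)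
    (γ : ℝ → Config N d X) (s : ℝ) :
    velocityJump (timeDilate c γ) s = c * velocityJump γ (c * s) := by
  simp only [velocityJump, leftLim_timeDilate hc, timeDilate_apply, scaleVel_apply, ← smul_sub,
    norm_smul, Real.norm_eq_abs, abs_of_pos hc, Finset.mul_sum]

/-- **The collision payload under time dilation**: `pay(γ_c)[a, b] = c · pay(γ)[ca, cb]` for
`c > 0` — each collision of `γ` in `[ca, cb]` is a collision of `γ_c` in `[a, b]` with `c` times
the jump (Serre's `Σ|[v]| ↦ μ Σ|[v]|` under `τ = μt`). [cite: Serre2024, §5 p. 1439] -/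
theorem collisionPayload_timeDilate [TopologicalSpace X] [T2Space X] (hc : 0 < c) (ε : ℝ)
    (γ : ℝ → Config N d X) (a b : ℝ) :
    collisionPayload G ε (timeDilate c γ) a b = c * collisionPayload G ε γ (c * a) (c * b) := by
  rw [collisionPayload_eq, collisionPayload_eq, mul_finsum_mem]
  refine finsum_mem_eq_of_bijOn (fun s => c * s) ⟨?_, ?_, ?_⟩ fun s _ =>
    velocityJump_timeDilate hc γ s
  · rintro s ⟨hs, hsa, hsb⟩
    rw [collisionTimes_timeDilate] at hs
    exact ⟨hs, mul_le_mul_of_nonneg_left hsa hc.le, mul_le_mul_of_nonneg_left hsb hc.le⟩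
  · exact fun s _ t _ hst => mul_left_cancel₀ hc.ne' hst
  · rintro t ⟨ht, hta, htb⟩
    refine ⟨c⁻¹ * t, ⟨?_, ?_, ?_⟩, mul_inv_cancel_left₀ hc.ne' t⟩
    · rw [collisionTimes_timeDilate, mem_preimage, mul_inv_cancel_left₀ hc.ne']
      exact ht
    · rw [le_inv_mul_iff₀ hc]
      exact hta
    · rw [inv_mul_le_iff₀ hc]
      exact htb

/-- The number of collisions is invariant: `#C(γ_c) ∩ [a, b] = #C(γ) ∩ [ca, cb]` (`c > 0`).
[folklore] -/
theorem numCollisions_timeDilate (hc : 0 < c) (ε : ℝ) (γ : ℝ → Config N d X) (a b : ℝ) :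
    numCollisions G ε (timeDilate c γ) a b = numCollisions G ε γ (c * a) (c * b) := by
  unfold numCollisions
  have himage : (fun s => c * s) '' (collisionTimes G ε (timeDilate c γ) ∩ Icc a b) =
      collisionTimes G ε γ ∩ Icc (c * a) (c * b) := by
    ext t
    simp only [mem_image, mem_inter_iff, collisionTimes_timeDilate, mem_preimage, mem_Icc]
    constructor
    · rintro ⟨s, ⟨hs, hsa, hsb⟩, rfl⟩
      exact ⟨hs, mul_le_mul_of_nonneg_left hsa hc.le, mul_le_mul_of_nonneg_left hsb hc.le⟩
    · rintro ⟨ht, hta, htb⟩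
      refine ⟨c⁻¹ * t, ⟨?_, ?_, ?_⟩, mul_inv_cancel_left₀ hc.ne' t⟩
      · rw [mul_inv_cancel_left₀ hc.ne']
        exact ht
      · rw [le_inv_mul_iff₀ hc]
        exact hta
      · rw [inv_mul_le_iff₀ hc]
        exact htb
  rw [← himage, Set.ncard_image_of_injective _ (mul_right_injective₀ hc.ne')]

/-! ## Closure of hard-sphere trajectories under time dilation -/

/-- **Time dilation of a hard-sphere trajectory is a hard-sphere trajectory** (`c > 0`): the
curve `s ↦ (x(cs), c v(cs))` stays in the domain, its collision times `c⁻¹ C(γ)` are locally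
finite, positions are continuous, free flight for time `t - s` at velocities `c v` is free flight
for time `c(t - s)` at velocities `v` (`freeFlight_scaleVel`), and at a collision the left limit
is the scaled incoming left limit of `γ` (`isIncoming_scaleVel_iff`) whose elastic reflection is
the scaled value (`collidePair_scaleVel`). Serre 2024 §5: "the change of time `τ = μt` yields
another motion, though with particle velocities `μv`". [cite: Serre2024, §5 p. 1439] -/
theorem IsHardSphereTrajectory.timeDilate [TopologicalSpace X] {ε : ℝ} {γ : ℝ → Config N d X}
    (h : IsHardSphereTrajectory G ε N γ) (hc : 0 < c) :
    IsHardSphereTrajectory G ε N (timeDilate c γ) where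
  mem s := by
    rw [timeDilate_apply, scaleVel_mem_hardSphereDomain_iff]
    exact h.mem _
  locFinite a b := by
    refine ((h.locFinite (c * a) (c * b)).preimage (mul_right_injective₀ hc.ne').injOn).subset ?_
    rintro s ⟨hs, hsa, hsb⟩
    rw [collisionTimes_timeDilate] at hs
    exact ⟨hs, mul_le_mul_of_nonneg_left hsa hc.le, mul_le_mul_of_nonneg_left hsb hc.le⟩
  pos_continuous i := by
    have hci : Continuous fun t => (γ t i).1 := h.pos_continuous i
    exact hci.comp (continuous_const_mul c)
  free s t hst hfree := by
    have hfree' : ∀ τ ∈ Ioc (c * s) (c * t), τ ∉ collisionTimes G ε γ := by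
      intro τ hτ hcol
      refine hfree (c⁻¹ * τ) ⟨?_, ?_⟩ ?_
      · rw [lt_inv_mul_iff₀ hc]
        exact hτ.1
      · rw [inv_mul_le_iff₀ hc]
        exact hτ.2
      · rw [collisionTimes_timeDilate, mem_preimage, mul_inv_cancel_left₀ hc.ne']
        exact hcol
    rw [timeDilate_apply, timeDilate_apply,
      h.free (c * s) (c * t) (mul_le_mul_of_nonneg_left hst hc.le) hfree', freeFlight_scaleVel,
      mul_sub]
  binary s i j hij hc' := by
    rw [timeDilate_apply, scaleVel_mem_contactSet_iff] at hc'
    obtain ⟨huniq, zl, hzl, hin, heq⟩ := h.binary (c * s) i j hij hc'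
    refine ⟨fun i' j' hij' hmem => huniq i' j' hij' ?_, scaleVel c zl, ?_, ?_, ?_⟩
    · rwa [timeDilate_apply, scaleVel_mem_contactSet_iff] at hmem
    · exact ((continuous_scaleVel c).tendsto zl).comp ((tendsto_comp_const_mul_nhdsLT_iff hc).2 hzl)
    · exact (isIncoming_scaleVel_iff hc).2 hin
    · rw [timeDilate_apply, heq, collidePair_scaleVel]

/-- The energy of the dilated curve: `E(γ_c(s)) = c² E(γ(cs))`. [cite: Serre2024, §5 p. 1439] -/
theorem configEnergy_timeDilate (c : ℝ) (γ : ℝ → Config N d X) (s : ℝ) :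
    configEnergy (timeDilate c γ s) = c ^ 2 * configEnergy (γ (c * s)) := by
  rw [timeDilate_apply, configEnergy_scaleVel]

end Kinetic

end

end Literature.Analysis.FluidPDE
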